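import Summits.Ventures.HodgeRepro2.T5CocompactCovolume
import Mathlib.MeasureTheory.Group.ModularCharacter
import Mathlib.MeasureTheory.Measure.Haar.Unique
import Mathlib.Topology.UrysohnsLemma
import Mathlib.Algebra.BigOperators.Finprod

/-!
# T5CocompactUnimodular — [DE] Proposition 9.1.2 for a discrete subgroup: a locally compact group
with a discrete cocompact subgroup is unimodular

Cell pub-hodge-repro2, seat p5, Tier 5 (route/T5-N4-p5.md, N4.3 v13 (B2)).  [DE] Theorem 9.2.2 is
printed for «a unimodular closed cocompact subgroup Γ» of a locally compact group `G` (p0234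
l. 25) and does NOT assume `G` unimodular: [DE] Proposition 9.1.2 (p0232 l. 5, «If G admits a
unimodular closed cocompact subgroup, then G is unimodular itself») supplies it.  Rows 59 / 61
take `[μ.IsMulRightInvariant]` as a hypothesis; this file proves it from the datum for a DISCRETE
`Γ` (which is unimodular: its Haar measure is the counting measure), following the printed proof
(p0232 l. 7 – p0233 l. 12) with the periodisation `ψ ↦ Σ_γ ψ (γ x)` in place of `∫_H`:

* `properlyDiscontinuousSMul_left`: the left action of a discrete `Γ` on a Hausdorff `G` is
  properly discontinuous (Mathlib's `Subgroup.properlyDiscontinuousSMul_of_tendsto_cofinite`);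
* `periodize Γ ψ x = ∑ᶠ γ : Γ, ψ (γ * x)`: a finite sum at every point for `ψ` with compact
  support (`finite_setOf_mul_mem_support`), continuous (`continuous_periodize`), left
  `Γ`-invariant (`periodize_mul_left`);
* `exists_periodize_eq_one`: for `G ⧸ Γ` compact there is `φ ≥ 0` continuous with compact support
  and `Σ_γ φ (γ x) = 1` for every `x` (Urysohn on a compact `K` with `Γ K = G`, then divide);
* `integral_eq_zero_of_periodize_eq_zero`: **the unfolding** — for a left Haar `μ`, if `ψ` is
  continuous with compact support and `Σ_γ ψ (γ x) = 0` for every `x`, then `∫ ψ dμ = 0`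
  (`∫ ψ = Σ_γ ∫ φ (γ x) ψ (x) = Σ_γ ∫ φ (y) ψ (γ⁻¹ y) = ∫ φ · Σ_γ ψ (γ⁻¹ ·) = 0`, left invariance
  and the reindexing `γ ↦ γ⁻¹` of the discrete group);
* `integral_mul_right_eq_self_of_periodize_eq_one`: hence `∫ φ (x g) dμ (x) = ∫ φ dμ` for every
  `g` (apply the unfolding to `φ (· g) − φ`, whose periodisation is `1 − 1`);
* `modularCharacterFun_eq_one_of_discrete_cocompact`: **the modular function is trivial**
  (`Δ (g) = ∫ φ (x g) dμ / ∫ φ dμ = 1` by Mathlib's `haarScalarFactor_eq_integral_div`);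
* `isMulRightInvariant_of_discrete_cocompact`: **every left Haar measure on `G` is
  right-invariant** (`map (· * g) μ = Δ (g) • μ = μ`, second countable uniqueness).

Imports row 62 (`T5CocompactCovolume`) and Mathlib.  Axioms: propext, Classical.choice, Quot.sound.
README §8(d): uses an L-value-free non-vanishing device: NO.
-/

namespace Summit.Ventures.HodgeRepro2.T5CocompactUnimodular

open MeasureTheory MeasureTheory.Measure Set Filter Topology Function
open scoped ENNReal NNReal Pointwise

variable {G : Type*} [Group G] [TopologicalSpace G] [IsTopologicalGroup G]

/-! ### The left action of a discrete subgroup -/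

/-- The left action `γ • x = γ * x` of a discrete subgroup of a Hausdorff topological group is
properly discontinuous (row 55's `properlyDiscontinuousSMul_op` for the left action). -/
theorem properlyDiscontinuousSMul_left [T2Space G] (Γ : Subgroup G) [DiscreteTopology Γ] :
    ProperlyDiscontinuousSMul Γ G :=
  Subgroup.properlyDiscontinuousSMul_of_tendsto_cofinite Γ
    (Subgroup.tendsto_coe_cofinite_of_discrete Γ (isDiscrete_iff_discreteTopology.2 inferInstance))

omit [TopologicalSpace G] [IsTopologicalGroup G] in
/-- A compact `K` with `mk '' K = univ` (row 62) gives a compact `K⁻¹` with `Γ * K⁻¹ = G`: every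
`x` has some `γ ∈ Γ` with `γ * x ∈ K⁻¹`. -/
theorem exists_mul_mem_inv_of_image_mk_eq_univ {Γ : Subgroup G} {K : Set G}
    (hK : (QuotientGroup.mk : G → G ⧸ Γ) '' K = univ) (x : G) :
    ∃ γ : Γ, (γ : G) * x ∈ K⁻¹ := by
  have hx : x⁻¹ ∈ ⋃ γ : Γ.op, γ • K := by
    rw [T5CocompactCovolume.iUnion_smul_eq_univ_of_image_mk_eq_univ hK]; exact mem_univ _
  obtain ⟨γ, k, hk, hkx⟩ := mem_iUnion.1 hx
  have hγ : (γ : Gᵐᵒᵖ).unop ∈ Γ := Subgroup.mem_op.1 γ.2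
  refine ⟨⟨(γ : Gᵐᵒᵖ).unop, hγ⟩, ?_⟩
  have hkx' : k * (γ : Gᵐᵒᵖ).unop = x⁻¹ := hkx
  show (γ : Gᵐᵒᵖ).unop * x ∈ K⁻¹
  rw [Set.mem_inv, mul_inv_rev, ← hkx', mul_inv_cancel_right]
  exact hk

/-! ### Periodisation -/

variable (Γ : Subgroup G)

/-- The `Γ`-periodisation `x ↦ Σ_γ ψ (γ * x)` (a finite sum at every point for `ψ` with compact
support and a properly discontinuous action, `finite_setOf_mul_mem_support`). -/
noncomputable def periodize (ψ : G → ℝ) (x : G) : ℝ :=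
  ∑ᶠ γ : Γ, ψ ((γ : G) * x)

variable {Γ}

omit [IsTopologicalGroup G] in
/-- For a compact `L` and `ψ` with compact support, only finitely many `γ ∈ Γ` have
`ψ (γ * x) ≠ 0` for some `x ∈ L` (proper discontinuity). -/
theorem finite_setOf_mul_mem_support [ProperlyDiscontinuousSMul Γ G] {ψ : G → ℝ}
    (hψ : HasCompactSupport ψ) {L : Set G} (hL : IsCompact L) :
    {γ : Γ | ∃ x ∈ L, ψ ((γ : G) * x) ≠ 0}.Finite := by
  refine (ProperlyDiscontinuousSMul.finite_disjoint_inter_image hL hψ).subset ?_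
  rintro γ ⟨x, hx, hne⟩
  exact ⟨(γ : G) * x, ⟨x, hx, rfl⟩, subset_tsupport _ hne⟩

omit [TopologicalSpace G] [IsTopologicalGroup G] in
/-- `periodize Γ ψ x` is the finite sum over any finite set containing the `γ` with
`ψ (γ * x) ≠ 0`. -/
theorem periodize_eq_sum {ψ : G → ℝ} {x : G} {F : Finset Γ}
    (hF : ∀ γ : Γ, ψ ((γ : G) * x) ≠ 0 → γ ∈ F) :
    periodize Γ ψ x = ∑ γ ∈ F, ψ ((γ : G) * x) :=
  finsum_eq_sum_of_support_subset _ fun γ hγ => hF γ hγ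

omit [TopologicalSpace G] [IsTopologicalGroup G] in
/-- The periodisation is left `Γ`-invariant (reindex by `γ ↦ γ * γ₀`). -/
theorem periodize_mul_left (ψ : G → ℝ) (γ₀ : Γ) (x : G) :
    periodize Γ ψ ((γ₀ : G) * x) = periodize Γ ψ x :=
  calc periodize Γ ψ ((γ₀ : G) * x) = ∑ᶠ γ : Γ, ψ (((Equiv.mulRight γ₀ γ : Γ) : G) * x) := by
        simp only [periodize, Equiv.coe_mulRight, Subgroup.coe_mul, mul_assoc]
    _ = ∑ᶠ γ' : Γ, ψ ((γ' : G) * x) :=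
        finsum_comp_equiv (Equiv.mulRight γ₀) (f := fun γ' : Γ => ψ ((γ' : G) * x))
    _ = periodize Γ ψ x := rfl

/-- The periodisation of a continuous function with compact support is continuous. -/
theorem continuous_periodize [WeaklyLocallyCompactSpace G] [ProperlyDiscontinuousSMul Γ G]
    {ψ : G → ℝ} (hψc : Continuous ψ) (hψs : HasCompactSupport ψ) :
    Continuous (periodize Γ ψ) := by
  refine continuous_iff_continuousAt.2 fun x => ?_
  obtain ⟨L, hL, hxL⟩ := exists_compact_mem_nhds x
  set F : Finset Γ := (finite_setOf_mul_mem_support hψs hL).toFinset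
  have hF : ∀ y ∈ L, periodize Γ ψ y = ∑ γ ∈ F, ψ ((γ : G) * y) := fun y hy =>
    periodize_eq_sum fun γ hγ => (finite_setOf_mul_mem_support hψs hL).mem_toFinset.2 ⟨y, hy, hγ⟩
  have hc : Continuous fun y : G => ∑ γ ∈ F, ψ ((γ : G) * y) :=
    continuous_finsetSum F fun γ _ => hψc.comp (continuous_const_mul (γ : G))
  exact hc.continuousAt.congr (eventually_of_mem hxL fun y hy => (hF y hy).symm)

omit [IsTopologicalGroup G] in
/-- `periodize` is additive on functions of compact support (finite supports). -/
theorem periodize_sub [ProperlyDiscontinuousSMul Γ G] {ψ₁ ψ₂ : G → ℝ}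
    (h₁ : HasCompactSupport ψ₁) (h₂ : HasCompactSupport ψ₂) (x : G) :
    periodize Γ (ψ₁ - ψ₂) x = periodize Γ ψ₁ x - periodize Γ ψ₂ x := by
  unfold periodize
  simp only [Pi.sub_apply]
  refine finsum_sub_distrib ?_ ?_
  · exact (finite_setOf_mul_mem_support h₁ isCompact_singleton).subset
      fun γ hγ => ⟨x, mem_singleton x, hγ⟩
  · exact (finite_setOf_mul_mem_support h₂ isCompact_singleton).subset
      fun γ hγ => ⟨x, mem_singleton x, hγ⟩

omit [TopologicalSpace G] [IsTopologicalGroup G] in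
/-- Periodising a right translate: `periodize Γ (ψ (· * g)) x = periodize Γ ψ (x * g)`. -/
theorem periodize_mul_right (ψ : G → ℝ) (g x : G) :
    periodize Γ (fun y => ψ (y * g)) x = periodize Γ ψ (x * g) := by
  simp only [periodize, mul_assoc]

omit [IsTopologicalGroup G] in
/-- If `ψ ≥ 0` and `ψ (γ₀ * x) = 1` for some `γ₀`, then `periodize Γ ψ x ≥ 1`. -/
theorem one_le_periodize [ProperlyDiscontinuousSMul Γ G] {ψ : G → ℝ} (hψs : HasCompactSupport ψ)
    (hψ0 : ∀ y, 0 ≤ ψ y) {x : G} {γ₀ : Γ} (h : ψ ((γ₀ : G) * x) = 1) :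
    1 ≤ periodize Γ ψ x := by
  classical
  obtain ⟨F, hF₀, hF⟩ : ∃ F : Finset Γ, γ₀ ∈ F ∧ ∀ γ : Γ, ψ ((γ : G) * x) ≠ 0 → γ ∈ F :=
    ⟨insert γ₀ (finite_setOf_mul_mem_support hψs (isCompact_singleton (x := x))).toFinset,
      Finset.mem_insert_self _ _, fun γ hγ => Finset.mem_insert_of_mem
        ((finite_setOf_mul_mem_support hψs isCompact_singleton).mem_toFinset.2 ⟨x, rfl, hγ⟩)⟩
  rw [periodize_eq_sum hF]
  calc (1 : ℝ) = ψ ((γ₀ : G) * x) := h.symm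
    _ ≤ ∑ γ ∈ F, ψ ((γ : G) * x) :=
      Finset.single_le_sum (f := fun γ : Γ => ψ ((γ : G) * x)) (fun γ _ => hψ0 _) hF₀

/-- **A partition of unity along `Γ`**: for `G` locally compact Hausdorff and `G ⧸ Γ` compact,
there is a continuous `φ ≥ 0` with compact support such that `Σ_γ φ (γ * x) = 1` for EVERY `x`
(take `ψ₀ = 1` on a compact `K'` with `Γ * K' = G` by Urysohn's lemma and divide by its
periodisation, which is `≥ 1`, continuous and `Γ`-invariant). -/
theorem exists_periodize_eq_one [T2Space G] [LocallyCompactSpace G] (Γ : Subgroup G)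
    [DiscreteTopology Γ] [CompactSpace (G ⧸ Γ)] :
    ∃ φ : G → ℝ, Continuous φ ∧ HasCompactSupport φ ∧ (∀ x, 0 ≤ φ x) ∧ (∃ x, φ x ≠ 0) ∧
      ∀ x, periodize Γ φ x = 1 := by
  haveI := properlyDiscontinuousSMul_left Γ
  obtain ⟨K, hKc, hK⟩ := T5CocompactCovolume.exists_isCompact_image_mk_eq_univ Γ
  obtain ⟨ψ₀, hψ₀K, -, hψ₀s, hψ₀01⟩ :=
    exists_continuous_one_zero_of_isCompact hKc.inv isClosed_empty (disjoint_empty _)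
  have hψ₀0 : ∀ y, 0 ≤ ψ₀ y := fun y => (hψ₀01 y).1
  have hS1 : ∀ x, 1 ≤ periodize Γ ψ₀ x := fun x => by
    obtain ⟨γ₀, hγ₀⟩ := exists_mul_mem_inv_of_image_mk_eq_univ hK x
    exact one_le_periodize hψ₀s hψ₀0 (hψ₀K hγ₀)
  have hSne : ∀ x, periodize Γ ψ₀ x ≠ 0 := fun x => (zero_lt_one.trans_le (hS1 x)).ne'
  have hSc : Continuous (periodize Γ ψ₀) := continuous_periodize ψ₀.continuous hψ₀s
  refine ⟨fun x => ψ₀ x * (periodize Γ ψ₀ x)⁻¹, ψ₀.continuous.mul (hSc.inv₀ hSne),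
    hψ₀s.mul_right, fun x => mul_nonneg (hψ₀0 x) (inv_nonneg.2 (zero_le_one.trans (hS1 x))),
    ?_, fun x => ?_⟩
  · obtain ⟨k, hk⟩ : K.Nonempty := by
      by_contra h
      rw [not_nonempty_iff_eq_empty] at h
      have : ((1 : G) : G ⧸ Γ) ∈ (QuotientGroup.mk : G → G ⧸ Γ) '' K := hK ▸ mem_univ _
      simp [h] at this
    refine ⟨k⁻¹, ?_⟩
    show ψ₀ k⁻¹ * (periodize Γ ψ₀ k⁻¹)⁻¹ ≠ 0
    rw [hψ₀K (Set.inv_mem_inv.2 hk), Pi.one_apply, one_mul]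
    exact inv_ne_zero (hSne _)
  · show ∑ᶠ γ : Γ, ψ₀ ((γ : G) * x) * (periodize Γ ψ₀ ((γ : G) * x))⁻¹ = 1
    simp_rw [periodize_mul_left]
    rw [← finsum_mul]
    exact mul_inv_cancel₀ (hSne x)

/-! ### The unfolding, and the modular function -/

variable [MeasurableSpace G] [BorelSpace G]

/-- **The unfolding identity forces `∫ ψ = 0` when `Σ_γ ψ (γ x) = 0`** ([DE] p0232 l. 7 –
p0233 l. 5): for a left-invariant `μ` finite on compacts, `φ` a partition of unity along `Γ`
(`Σ_γ φ (γ x) = 1`) and `ψ` continuous with compact support and `Σ_γ ψ (γ x) = 0` everywhere,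
`∫ ψ dμ = Σ_γ ∫ φ (γ x) ψ (x) dμ = Σ_γ ∫ φ (y) ψ (γ⁻¹ y) dμ = ∫ φ (y) Σ_γ ψ (γ⁻¹ y) dμ = 0`. -/
theorem integral_eq_zero_of_periodize_eq_zero [ProperlyDiscontinuousSMul Γ G] (μ : Measure G)
    [μ.IsMulLeftInvariant] [IsFiniteMeasureOnCompacts μ] {φ : G → ℝ} (hφc : Continuous φ)
    (hφs : HasCompactSupport φ) (hφ1 : ∀ x, periodize Γ φ x = 1) {ψ : G → ℝ}
    (hψc : Continuous ψ) (hψs : HasCompactSupport ψ) (hψ0 : ∀ x, periodize Γ ψ x = 0) :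
    ∫ x, ψ x ∂μ = 0 := by
  set F : Finset Γ := (finite_setOf_mul_mem_support hφs hψs).toFinset with hFdef
  have hmemF : ∀ γ : Γ, ∀ x ∈ tsupport ψ, φ ((γ : G) * x) ≠ 0 → γ ∈ F := fun γ x hx h =>
    (finite_setOf_mul_mem_support hφs hψs).mem_toFinset.2 ⟨x, hx, h⟩
  -- Step 1: `ψ x = Σ_{γ ∈ F} φ (γ x) ψ x`
  have h1 : ∀ x, ψ x = ∑ γ ∈ F, φ ((γ : G) * x) * ψ x := fun x => by
    by_cases hx : ψ x = 0
    · simp [hx]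
    · rw [← Finset.sum_mul, ← periodize_eq_sum (fun γ hγ => hmemF γ x (subset_tsupport ψ hx) hγ),
        hφ1, one_mul]
  -- integrability of the pieces
  have hint : ∀ γ : Γ, Integrable (fun x => φ ((γ : G) * x) * ψ x) μ := fun γ =>
    ((hφc.comp (continuous_const_mul _)).mul hψc).integrable_of_hasCompactSupport
      (hψs.mul_left)
  have hint' : ∀ γ : Γ, Integrable (fun y => φ y * ψ ((γ : G)⁻¹ * y)) μ := fun γ =>
    (hφc.mul (hψc.comp (continuous_const_mul _))).integrable_of_hasCompactSupport hφs.mul_right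
  -- Step 2–3: unfold and substitute `y = γ x` (left invariance)
  have h3 : ∀ γ : Γ, ∫ x, φ ((γ : G) * x) * ψ x ∂μ = ∫ y, φ y * ψ ((γ : G)⁻¹ * y) ∂μ := fun γ => by
    rw [← integral_mul_left_eq_self (fun y => φ y * ψ ((γ : G)⁻¹ * y)) (γ : G)]
    simp only [inv_mul_cancel_left]
  calc ∫ x, ψ x ∂μ = ∫ x, ∑ γ ∈ F, φ ((γ : G) * x) * ψ x ∂μ := by simp_rw [← h1]
    _ = ∑ γ ∈ F, ∫ x, φ ((γ : G) * x) * ψ x ∂μ := integral_finsetSum F fun γ _ => hint γ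
    _ = ∑ γ ∈ F, ∫ y, φ y * ψ ((γ : G)⁻¹ * y) ∂μ := Finset.sum_congr rfl fun γ _ => h3 γ
    _ = ∫ y, ∑ γ ∈ F, φ y * ψ ((γ : G)⁻¹ * y) ∂μ := (integral_finsetSum F fun γ _ => hint' γ).symm
    _ = ∫ y, (0 : ℝ) ∂μ := by
      refine integral_congr_ae (Eventually.of_forall fun y => ?_)
      show ∑ γ ∈ F, φ y * ψ ((γ : G)⁻¹ * y) = 0
      rw [← Finset.mul_sum]
      by_cases hy : φ y = 0
      · simp [hy]
      · -- Step 5: `Σ_{γ ∈ F} ψ (γ⁻¹ y) = periodize Γ ψ y = 0`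
        have : ∑ γ ∈ F, ψ ((γ : G)⁻¹ * y) = periodize Γ ψ y := by
          rw [periodize_eq_sum (F := F.map (Equiv.inv Γ).toEmbedding)]
          · refine Finset.sum_equiv (Equiv.inv Γ) (fun γ => ?_) fun γ _ => ?_
            · rw [Finset.mem_map_equiv]
              simp
            · simp
          · intro γ hγ
            rw [Finset.mem_map_equiv]
            refine hmemF _ _ (subset_tsupport ψ hγ) ?_
            simpa [mul_assoc] using hy
        rw [this, hψ0, mul_zero]
    _ = 0 := integral_zero _ _

/-- **Right translation preserves `∫ φ`** for a partition of unity `φ` along `Γ`: apply the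
unfolding to `φ (· * g) − φ`, whose periodisation is `1 − 1 = 0`. -/
theorem integral_mul_right_eq_self_of_periodize_eq_one [ProperlyDiscontinuousSMul Γ G]
    (μ : Measure G) [μ.IsMulLeftInvariant] [IsFiniteMeasureOnCompacts μ] {φ : G → ℝ}
    (hφc : Continuous φ) (hφs : HasCompactSupport φ) (hφ1 : ∀ x, periodize Γ φ x = 1) (g : G) :
    ∫ x, φ (x * g) ∂μ = ∫ x, φ x ∂μ := by
  have hgc : Continuous fun x => φ (x * g) := hφc.comp (continuous_mul_const g)
  have hgs : HasCompactSupport fun x => φ (x * g) := hφs.comp_homeomorph (Homeomorph.mulRight g)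
  have h0 : ∫ x, ((fun x => φ (x * g)) - φ) x ∂μ = 0 :=
    integral_eq_zero_of_periodize_eq_zero μ hφc hφs hφ1 (hgc.sub hφc) (hgs.sub hφs) fun x => by
      rw [periodize_sub hgs hφs, periodize_mul_right, hφ1, hφ1, sub_self]
  simp only [Pi.sub_apply] at h0
  rw [integral_sub (hgc.integrable_of_hasCompactSupport hgs)
    (hφc.integrable_of_hasCompactSupport hφs)] at h0
  exact sub_eq_zero.1 h0

/-- **[DE] Proposition 9.1.2 for a discrete subgroup — the modular function is trivial**: if `G`
is a locally compact Hausdorff group with a discrete subgroup `Γ` such that `G ⧸ Γ` is compact,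
then `Δ_G ≡ 1`. -/
theorem modularCharacterFun_eq_one_of_discrete_cocompact [T2Space G] [LocallyCompactSpace G]
    (Γ : Subgroup G) [DiscreteTopology Γ] [CompactSpace (G ⧸ Γ)] (μ : Measure G) [IsHaarMeasure μ]
    (g : G) :
    modularCharacterFun g = 1 := by
  haveI := properlyDiscontinuousSMul_left Γ
  obtain ⟨φ, hφc, hφs, hφ0, ⟨x₀, hx₀⟩, hφ1⟩ := exists_periodize_eq_one Γ
  have hint : ∫ x, φ x ∂μ ≠ 0 :=
    (hφc.integral_pos_of_hasCompactSupport_nonneg_nonzero hφs hφ0 hx₀).ne'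
  apply NNReal.coe_injective
  rw [modularCharacterFun_eq_haarScalarFactor μ g,
    haarScalarFactor_eq_integral_div _ _ hφc hφs hint,
    integral_map (measurable_mul_const g).aemeasurable hφc.aestronglyMeasurable,
    integral_mul_right_eq_self_of_periodize_eq_one μ hφc hφs hφ1 g, div_self hint, NNReal.coe_one]

/-- **A locally compact group with a discrete cocompact subgroup is unimodular** ([DE]
Proposition 9.1.2 for a discrete subgroup, second countable form): every left Haar measure is
right-invariant. -/
theorem isMulRightInvariant_of_discrete_cocompact [T2Space G] [LocallyCompactSpace G]
    [SecondCountableTopology G] (Γ : Subgroup G) [DiscreteTopology Γ] [CompactSpace (G ⧸ Γ)]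
    (μ : Measure G) [IsHaarMeasure μ] : IsMulRightInvariant μ := by
  refine ⟨fun g => ?_⟩
  rw [isMulLeftInvariant_eq_smul (map (· * g) μ) μ, ← modularCharacterFun_eq_haarScalarFactor μ g,
    modularCharacterFun_eq_one_of_discrete_cocompact Γ μ g, one_smul]

end Summit.Ventures.HodgeRepro2.T5CocompactUnimodular
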